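import Literature.MathematicalPhysics.KineticTheory.TaggedSphereLinearBoltzmannInputs
import Literature.MathematicalPhysics.KineticTheory.HardSphereDuhamelFormula
import Literature.MathematicalPhysics.KineticTheory.HardSphereAdjunctionPullback
import HarnessLib

/-!
# BGSR Theorem 2.2 (2.9) reduced to the one-step integrated BBGKY hierarchy of the tagged
# hard-sphere system (generic and contact-trace forms)
(Bodineau–Gallagher–Saint-Raymond, Invent. Math. 203 (2016) = arXiv:1305.3397v2, §3.1 p. 9 (the
BBGKY hierarchy in integrated form and the iterated Duhamel formula, Remark 3.1) and Thm 2.2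
(2.9) p. 7; trunk T-KINETIC, topic MathematicalPhysics/KineticTheory; the top of the bottom-up
plan towards the named fact `bgsr_linearBoltzmannApprox` (`TaggedSphereDiffusion`).)

`bgsr_linearBoltzmannApprox_of_domainInputs` (`TaggedSphereLinearBoltzmannInputs`) proves BGSR's
Theorem 2.2 (2.9) from three inputs (S), (R), (Reg) on the hard-sphere dynamics. Two of them are
now theorems of the tree: (Reg) is `ae_bgsrRegular_one` (`HardSphereBBGKYRegularity`) and (R) is
`hsHierarchyModel_respectsAEOn_all` (`HardSphereAdjunctionPullback`; independently
`respectsAEOn_hsHierarchyModel`, `HardSphereBBGKYRobustness`). The third, (S) — the iterated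
Duhamel formula up to null sets for the marginals `f_N^{(s)}(t)` (`bgsrMarginalFamily`) of the
transported BGSR datum along the regularised flows — is reduced by `HardSphereDuhamelFormula`
(`hs_seriesFamily_ae_eq_of_oneStep`) to the ONE-STEP integrated hierarchy in its two forms:

* (H1) for every level `k` and `t ≥ 0`, for Lebesgue-a.e. `Z`,
  `f^{(k)}(t, Z) = f^{(k)}(0, Φ^k_{-t} Z) + ∫_0^t (C^{out}_{k,k+1} f^{(k+1)}(τ))(Φ^k_{τ-t} Z) dτ`
  (BGSR §3.1 (3.3) integrated; CIP 1994 Thm 4.3.1; Spohn 2006 Prop. 5);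
* (H1♯) the same identity AT the outgoing adjoined contact configurations
  `outRep_i (gainConfig Y i ω v)` (`ω·(v - v_i) > 0`) and `outRep_i (lossConfig Y i ω v)`
  (`ω·(v - v_i) < 0`) of the domain, for `dτ dY dσ dv`-almost every `(τ, Y, ω, v)` with `τ > 0`
  (the boundary trace of the hierarchy: CIP 1994 (4.3.4), Spohn 2006 (8)).

This file PROVES the instantiation: the marginal family is jointly measurable and in the Lanford
class uniformly in time (`measurable_bgsrMarginalFamily_uncurry`, `isNiceT_bgsrMarginalFamily`),
hence `bgsr_seriesFamily_ae_eq_of_oneStep` ((S) for BGSR's marginals from (H1), (H1♯)) and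
**`bgsr_linearBoltzmannApprox_of_oneStep`: the named fact from (H1), (H1♯) alone** (each asked in
dimension `d ≥ 2`, for `0 < ε < 1/2` in the regime `N(2ε)^d ≤ 1/2`, `β > 0`, continuous
probability densities `0 ≤ ρ⁰ ≤ R`). No definition, no named fact.

## References

* T. Bodineau, I. Gallagher, L. Saint-Raymond, *The Brownian motion as the limit of a
  deterministic system of hard-spheres*, Invent. Math. 203 (2016) 493–553 = arXiv:1305.3397v2,
  Thm 2.2 (2.9) p. 7; §3.1 (3.3), iterated Duhamel formula and Remark 3.1, p. 9.
* C. Cercignani, R. Illner, M. Pulvirenti, *The Mathematical Theory of Dilute Gases*, Springer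
  (1994), §4.3 (4.3.4), Thm 4.3.1.
* H. Spohn, *On the integrated form of the BBGKY hierarchy for hard spheres*,
  arXiv:math-ph/0605068, (8), Prop. 5, Thm 11.
-/

open MeasureTheory MeasureTheory.Measure Metric Real Set Filter Function
open scoped InnerProductSpace ENNReal
open Literature.Analysis.FluidPDE (Config configEnergy GCState duhamelTerm duhamelTerm_zero
  duhamelTerm_succ Geometry hardSphereDomain lossConfig gainConfig nthMarginal hsTransport)

namespace Literature.MathematicalPhysics.KineticTheory

noncomputable section

set_option synthInstance.maxSize 1024

section Kinetic

variable {d : Type*} [Fintype d]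

attribute [local instance] sigmaFinite_volume_phaseSpace

section Family

variable {ε : ℝ} (hε : 0 < ε) (hε' : ε < 2⁻¹) (N : ℕ) (β : ℝ) (ρ₀ : UnitAddTorus d → ℝ)

/-! ## §1. The marginal family is jointly measurable and in the Lanford class uniformly in time -/

/-- **Joint measurability of the marginal family** `(t, Z_k) ↦ f_N^{(k)}(t, Z_k)` (measurable
`ρ⁰`): the integrand `(t, Z_k, Z'') ↦ 1_{good} f_N^0(Φ^{N+1}_{-t}(Z_k, Z''))` is jointly measurable
(`Alexander.measurable_regFlow_uncurry`) and parametric Bochner integrals of jointly measurable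
functions are measurable (`StronglyMeasurable.integral_prod_right'`). [folklore] -/
theorem measurable_bgsrMarginalFamily_uncurry (hρ₀m : Measurable ρ₀) (k : ℕ) :
    Measurable fun p : ℝ × Config k d (UnitAddTorus d) => bgsrMarginalFamily (d := d) hε hε' N β ρ₀ k p.1 p.2 := by
  classical
  by_cases hk : k ≤ N + 1
  · set Φ := Literature.Analysis.FluidPDE.Alexander.regHardSphereFlow (d := d) hε hε' (N + 1) with hΦ
    set f₀ : Config (N + 1) d (UnitAddTorus d) → ℝ := bgsrInitialDensity ε N β ρ₀ with hf₀
    -- the transported density, jointly in `(t, z)`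
    have hpair : Measurable fun q : ℝ × Config (N + 1) d (UnitAddTorus d) =>
        ((-q.1, q.2) : ℝ × Config (N + 1) d (UnitAddTorus d)) := measurable_fst.neg.prodMk measurable_snd
    have hflow : Measurable fun q : ℝ × Config (N + 1) d (UnitAddTorus d) =>
        Literature.Analysis.FluidPDE.Alexander.regFlow (Literature.Analysis.FluidPDE.Torus.geometry d) ε (-q.1) q.2 := by
      have h := (Literature.Analysis.FluidPDE.Alexander.measurable_regFlow_uncurry (d := d) (N := N + 1) hε').comp hpair
      exact h
    have hF : Measurable fun q : ℝ × Config (N + 1) d (UnitAddTorus d) =>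
        f₀ (Literature.Analysis.FluidPDE.Alexander.regFlow (Literature.Analysis.FluidPDE.Torus.geometry d) ε (-q.1) q.2) :=
      (measurable_bgsrInitialDensity hρ₀m ε N β).comp hflow
    have hg : MeasurableSet {q : ℝ × Config (N + 1) d (UnitAddTorus d) | q.2 ∈ Φ.good} :=
      Φ.measurableSet_good.preimage measurable_snd
    have hH' : Measurable fun q : ℝ × Config (N + 1) d (UnitAddTorus d) =>
        ({q : ℝ × Config (N + 1) d (UnitAddTorus d) | q.2 ∈ Φ.good}).indicator
          (fun q => f₀ (Literature.Analysis.FluidPDE.Alexander.regFlow (Literature.Analysis.FluidPDE.Torus.geometry d) ε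
            (-q.1) q.2)) q := hF.indicator hg
    have heq : (fun q : ℝ × Config (N + 1) d (UnitAddTorus d) => Φ.good.indicator (hsTransport Φ q.1 f₀) q.2) =
        fun q => ({q : ℝ × Config (N + 1) d (UnitAddTorus d) | q.2 ∈ Φ.good}).indicator
          (fun q => f₀ (Literature.Analysis.FluidPDE.Alexander.regFlow (Literature.Analysis.FluidPDE.Torus.geometry d) ε
            (-q.1) q.2)) q := by
      funext q
      by_cases h : q.2 ∈ Φ.good
      · rw [Set.indicator_of_mem h, Set.indicator_of_mem (show q ∈ {q : ℝ × Config (N + 1) d (UnitAddTorus d) |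
          q.2 ∈ Φ.good} from h)]
        rfl
      · rw [Set.indicator_of_notMem h, Set.indicator_of_notMem (show q ∉ {q : ℝ × Config (N + 1) d (UnitAddTorus d) |
          q.2 ∈ Φ.good} from h)]
    have hH : Measurable fun q : ℝ × Config (N + 1) d (UnitAddTorus d) => Φ.good.indicator (hsTransport Φ q.1 f₀) q.2 := by
      rw [heq]; exact hH'
    -- the recast juxtaposition `((t, Z), Z'') ↦ (t, (Z, Z''))`
    obtain ⟨e, he, -⟩ := Literature.Analysis.FluidPDE.exists_appendEquiv k (N + 1 - k) (UnitAddTorus d × EuclideanSpace ℝ d)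
    have happ : Measurable fun x : (ℝ × Config k d (UnitAddTorus d)) × Config (N + 1 - k) d (UnitAddTorus d) =>
        Fin.append x.1.2 x.2 := by
      have h1 : (fun x : (ℝ × Config k d (UnitAddTorus d)) × Config (N + 1 - k) d (UnitAddTorus d) => Fin.append x.1.2 x.2) =
          fun x => e (x.1.2, x.2) := by
        funext x; rw [he]
      rw [h1]
      exact e.measurable.comp (measurable_fst.snd.prodMk measurable_snd)
    have hR : Measurable fun x : (ℝ × Config k d (UnitAddTorus d)) × Config (N + 1 - k) d (UnitAddTorus d) =>
        ((x.1.1, fun i => Fin.append x.1.2 x.2 (Fin.cast (Nat.add_sub_of_le hk).symm i)) : ℝ × Config (N + 1) d (UnitAddTorus d)) :=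
      measurable_fst.fst.prodMk (measurable_pi_lambda _ fun i => (measurable_pi_apply _).comp happ)
    have hJ := hH.comp hR
    have hint := hJ.stronglyMeasurable.integral_prod_right' (ν := (volume : Measure (Config (N + 1 - k) d (UnitAddTorus d))))
    have hfun : (fun p : ℝ × Config k d (UnitAddTorus d) => bgsrMarginalFamily (d := d) hε hε' N β ρ₀ k p.1 p.2) =
        fun p => ∫ zm : Config (N + 1 - k) d (UnitAddTorus d),
          (fun x : (ℝ × Config k d (UnitAddTorus d)) × Config (N + 1 - k) d (UnitAddTorus d) =>
            Φ.good.indicator (hsTransport Φ x.1.1 f₀)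
              (fun i => Fin.append x.1.2 x.2 (Fin.cast (Nat.add_sub_of_le hk).symm i))) (p, zm) := by
      funext p
      rw [bgsrMarginalFamily_apply, Literature.Analysis.FluidPDE.nthMarginal_of_le hk]
      rfl
    rw [hfun]
    exact hint.measurable
  · have h0 : (fun p : ℝ × Config k d (UnitAddTorus d) => bgsrMarginalFamily (d := d) hε hε' N β ρ₀ k p.1 p.2) = fun _ => 0 := by
      funext p
      rw [bgsrMarginalFamily_eq_zero_of_lt hε hε' N β ρ₀ (not_le.1 hk) p.1]
      rfl
    rw [h0]
    exact measurable_const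

/-- **The marginal family is in the Lanford class, uniformly in time** (`IsNiceT` on every
horizon): joint measurability and the a priori bound (4.6)
`|f_N^{(k)}(t)| ≤ R C'^k e^{-β H_k}` at every point (`abs_bgsrMarginalFamily_le`).
[cite: BodineauGallagherSaintRaymondInvent2016, §4.1 Prop. 4.1 and §4.3 (4.6), pp. 11–12] -/
theorem isNiceT_bgsrMarginalFamily (hβ : 0 < β) (hρ₀m : Measurable ρ₀) {R : ℝ} (hρ₀0 : ∀ x, 0 ≤ ρ₀ x)
    (hR : ∀ x, ρ₀ x ≤ R) (hN : (N : ℝ) * (2 * ε) ^ Fintype.card d ≤ 2⁻¹) (k : ℕ) (T : ℝ) :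
    IsNiceT T (bgsrMarginalFamily (d := d) hε hε' N β ρ₀ k) :=
  ⟨measurable_bgsrMarginalFamily_uncurry hε hε' N β ρ₀ hρ₀m k, R * (max 1 (2 * maxwellianConst d β)) ^ k, β, hβ,
    fun t _ Z => abs_bgsrMarginalFamily_le hε hε' N β ρ₀ hβ hρ₀0 hR hN k t Z⟩

/-! ## §2. (S) for BGSR's marginals from the one-step hierarchy -/

/-- **The iterated Duhamel formula up to null sets for BGSR's marginals ((S)), from the one-step
hierarchy (H1) and its contact-trace form (H1♯)** (`d ≥ 2`, `0 < ε < 1/2`, `N(2ε)^d ≤ 1/2`,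
`β > 0`, measurable `0 ≤ ρ⁰ ≤ R`): `hs_seriesFamily_ae_eq_of_oneStep` (`HardSphereDuhamelFormula`)
for the family `bgsrMarginalFamily` (Lanford class: `isNiceT_bgsrMarginalFamily`; vanishing off
the domains and above `N + 1`: `bgsrMarginalFamily_eq_zero_of_not_mem`, `…_of_lt`), the
pull-back predicates being theorems (`gainPullback`, `lossPullback`).
[cite: BodineauGallagherSaintRaymondInvent2016, §3.1 and Remark 3.1, p. 9] -/
theorem bgsr_seriesFamily_ae_eq_of_oneStep (hd : 2 ≤ Fintype.card d) (hβ : 0 < β) (hρ₀m : Measurable ρ₀) {R : ℝ}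
    (hρ₀0 : ∀ x, 0 ≤ ρ₀ x) (hR : ∀ x, ρ₀ x ≤ R) (hN : (N : ℝ) * (2 * ε) ^ Fintype.card d ≤ 2⁻¹)
    (hH1 : ∀ (k : ℕ) (t : ℝ), 0 ≤ t → ∀ᵐ Z : Config k d (UnitAddTorus d),
          bgsrMarginalFamily hε hε' N β ρ₀ k t Z =
            (hsHierarchyModel (d := d) hε hε' (N + 1)).transport k t (bgsrMarginalFamily hε hε' N β ρ₀ k 0) Z +
              ∫ τ in (0 : ℝ)..t, (hsHierarchyModel (d := d) hε hε' (N + 1)).transport k (t - τ)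
                ((hsHierarchyModel (d := d) hε hε' (N + 1)).op k (bgsrMarginalFamily hε hε' N β ρ₀ (k + 1) τ)) Z)
    (hH : ∀ (k : ℕ) (i : Fin k), ∀ᵐ p : (ℝ × Config k d (UnitAddTorus d)) × (sphere (0 : EuclideanSpace ℝ d) 1 × EuclideanSpace ℝ d)
          ∂(((volume : Measure ℝ).prod (volume : Measure (Config k d (UnitAddTorus d)))).prod
            ((sphereMeasure (E := EuclideanSpace ℝ d)).prod (volume : Measure (EuclideanSpace ℝ d)))),
        (0 < p.1.1 → 0 < ⟪(p.2.1 : EuclideanSpace ℝ d), p.2.2 - (p.1.2 i).2⟫_ℝ →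
          gainConfig (Literature.Analysis.FluidPDE.Torus.geometry d) ε p.1.2 i p.2.1 p.2.2 ∈ hardSphereDomain (Literature.Analysis.FluidPDE.Torus.geometry d) (k + 1) ε →
          (bgsrMarginalFamily hε hε' N β ρ₀) (k + 1) p.1.1 (outRep (Literature.Analysis.FluidPDE.Torus.geometry d) k i (gainConfig (Literature.Analysis.FluidPDE.Torus.geometry d) ε p.1.2 i p.2.1 p.2.2)) =
            (hsHierarchyModel (d := d) hε hε' (N + 1)).transport (k + 1) p.1.1 ((bgsrMarginalFamily hε hε' N β ρ₀) (k + 1) 0)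
                (outRep (Literature.Analysis.FluidPDE.Torus.geometry d) k i (gainConfig (Literature.Analysis.FluidPDE.Torus.geometry d) ε p.1.2 i p.2.1 p.2.2)) +
              ∫ τ' in (0 : ℝ)..p.1.1, (hsHierarchyModel (d := d) hε hε' (N + 1)).transport (k + 1) (p.1.1 - τ')
                ((hsHierarchyModel (d := d) hε hε' (N + 1)).op (k + 1) ((bgsrMarginalFamily hε hε' N β ρ₀) (k + 1 + 1) τ'))
                (outRep (Literature.Analysis.FluidPDE.Torus.geometry d) k i (gainConfig (Literature.Analysis.FluidPDE.Torus.geometry d) ε p.1.2 i p.2.1 p.2.2))) ∧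
        (0 < p.1.1 → ⟪(p.2.1 : EuclideanSpace ℝ d), p.2.2 - (p.1.2 i).2⟫_ℝ < 0 →
          lossConfig (Literature.Analysis.FluidPDE.Torus.geometry d) ε p.1.2 i p.2.1 p.2.2 ∈ hardSphereDomain (Literature.Analysis.FluidPDE.Torus.geometry d) (k + 1) ε →
          (bgsrMarginalFamily hε hε' N β ρ₀) (k + 1) p.1.1 (outRep (Literature.Analysis.FluidPDE.Torus.geometry d) k i (lossConfig (Literature.Analysis.FluidPDE.Torus.geometry d) ε p.1.2 i p.2.1 p.2.2)) =
            (hsHierarchyModel (d := d) hε hε' (N + 1)).transport (k + 1) p.1.1 ((bgsrMarginalFamily hε hε' N β ρ₀) (k + 1) 0)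
                (outRep (Literature.Analysis.FluidPDE.Torus.geometry d) k i (lossConfig (Literature.Analysis.FluidPDE.Torus.geometry d) ε p.1.2 i p.2.1 p.2.2)) +
              ∫ τ' in (0 : ℝ)..p.1.1, (hsHierarchyModel (d := d) hε hε' (N + 1)).transport (k + 1) (p.1.1 - τ')
                ((hsHierarchyModel (d := d) hε hε' (N + 1)).op (k + 1) ((bgsrMarginalFamily hε hε' N β ρ₀) (k + 1 + 1) τ'))
                (outRep (Literature.Analysis.FluidPDE.Torus.geometry d) k i (lossConfig (Literature.Analysis.FluidPDE.Torus.geometry d) ε p.1.2 i p.2.1 p.2.2))))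
    (s : ℕ) {t : ℝ} (ht : 0 ≤ t) :
    (hsHierarchyModel (d := d) hε hε' (N + 1)).seriesFamily (N + 1)
        (fun k => bgsrMarginalFamily hε hε' N β ρ₀ k 0) s t =ᵐ[volume]
      bgsrMarginalFamily hε hε' N β ρ₀ s t :=
  hs_seriesFamily_ae_eq_of_oneStep hε hε' (N + 1) (gainPullback hε hε' hd) (lossPullback hε hε' hd) (Nmax := N + 1)
    (fun k T => isNiceT_bgsrMarginalFamily hε hε' N β ρ₀ hβ hρ₀m hρ₀0 hR hN k T)
    (fun k t _ hZ => bgsrMarginalFamily_eq_zero_of_not_mem hε hε' N β ρ₀ k t hZ)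
    (fun _ hk t => bgsrMarginalFamily_eq_zero_of_lt hε hε' N β ρ₀ hk t) hH1 hH s ht

end Family

/-! ## §3. BGSR Theorem 2.2 (2.9) from the one-step hierarchy alone -/

/-- **BGSR Theorem 2.2 (2.9) (`bgsr_linearBoltzmannApprox`) from the one-step integrated BBGKY
hierarchy of the tagged hard-sphere system in its generic form (H1) and its contact-trace form
(H1♯)** — the only statements about the hard-sphere dynamics not proved in the tree, each asked in
dimension `d ≥ 2`, for `0 < ε < 1/2` in the regime `N(2ε)^d ≤ 1/2`, `β > 0` and continuous
probability densities `0 ≤ ρ⁰ ≤ R`: `bgsr_linearBoltzmannApprox_of_domainInputs` with (S) from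
`bgsr_seriesFamily_ae_eq_of_oneStep`, (R) from `hsHierarchyModel_respectsAEOn_all` and (Reg) from
`ae_bgsrRegular_one`. [cite: BodineauGallagherSaintRaymondInvent2016, Thm 2.2 (2.9), p. 7; §3.1 p. 9] -/
theorem bgsr_linearBoltzmannApprox_of_oneStep [DecidableEq d]
    (hH1 : 2 ≤ Fintype.card d → ∀ (N : ℕ) (ε : ℝ) (hε : 0 < ε) (hε' : ε < 2⁻¹),
      (N : ℝ) * (2 * ε) ^ Fintype.card d ≤ 2⁻¹ →
      ∀ (β : ℝ), 0 < β → ∀ (R : ℝ) (ρ₀ : UnitAddTorus d → ℝ), Continuous ρ₀ → (∀ x, 0 ≤ ρ₀ x) →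
      (∀ x, ρ₀ x ≤ R) → ∫ x, ρ₀ x = 1 →
        ∀ (k : ℕ) (t : ℝ), 0 ≤ t → ∀ᵐ Z : Config k d (UnitAddTorus d),
          bgsrMarginalFamily hε hε' N β ρ₀ k t Z =
            (hsHierarchyModel (d := d) hε hε' (N + 1)).transport k t (bgsrMarginalFamily hε hε' N β ρ₀ k 0) Z +
              ∫ τ in (0 : ℝ)..t, (hsHierarchyModel (d := d) hε hε' (N + 1)).transport k (t - τ)
                ((hsHierarchyModel (d := d) hε hε' (N + 1)).op k (bgsrMarginalFamily hε hε' N β ρ₀ (k + 1) τ)) Z)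
    (hH : 2 ≤ Fintype.card d → ∀ (N : ℕ) (ε : ℝ) (hε : 0 < ε) (hε' : ε < 2⁻¹),
      (N : ℝ) * (2 * ε) ^ Fintype.card d ≤ 2⁻¹ →
      ∀ (β : ℝ), 0 < β → ∀ (R : ℝ) (ρ₀ : UnitAddTorus d → ℝ), Continuous ρ₀ → (∀ x, 0 ≤ ρ₀ x) →
      (∀ x, ρ₀ x ≤ R) → ∫ x, ρ₀ x = 1 →
        ∀ (k : ℕ) (i : Fin k), ∀ᵐ p : (ℝ × Config k d (UnitAddTorus d)) × (sphere (0 : EuclideanSpace ℝ d) 1 × EuclideanSpace ℝ d)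
            ∂(((volume : Measure ℝ).prod (volume : Measure (Config k d (UnitAddTorus d)))).prod
              ((sphereMeasure (E := EuclideanSpace ℝ d)).prod (volume : Measure (EuclideanSpace ℝ d)))),
          (0 < p.1.1 → 0 < ⟪(p.2.1 : EuclideanSpace ℝ d), p.2.2 - (p.1.2 i).2⟫_ℝ →
            gainConfig (Literature.Analysis.FluidPDE.Torus.geometry d) ε p.1.2 i p.2.1 p.2.2 ∈ hardSphereDomain (Literature.Analysis.FluidPDE.Torus.geometry d) (k + 1) ε →
            (bgsrMarginalFamily hε hε' N β ρ₀) (k + 1) p.1.1 (outRep (Literature.Analysis.FluidPDE.Torus.geometry d) k i (gainConfig (Literature.Analysis.FluidPDE.Torus.geometry d) ε p.1.2 i p.2.1 p.2.2)) =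
              (hsHierarchyModel (d := d) hε hε' (N + 1)).transport (k + 1) p.1.1 ((bgsrMarginalFamily hε hε' N β ρ₀) (k + 1) 0)
                  (outRep (Literature.Analysis.FluidPDE.Torus.geometry d) k i (gainConfig (Literature.Analysis.FluidPDE.Torus.geometry d) ε p.1.2 i p.2.1 p.2.2)) +
                ∫ τ' in (0 : ℝ)..p.1.1, (hsHierarchyModel (d := d) hε hε' (N + 1)).transport (k + 1) (p.1.1 - τ')
                  ((hsHierarchyModel (d := d) hε hε' (N + 1)).op (k + 1) ((bgsrMarginalFamily hε hε' N β ρ₀) (k + 1 + 1) τ'))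
                  (outRep (Literature.Analysis.FluidPDE.Torus.geometry d) k i (gainConfig (Literature.Analysis.FluidPDE.Torus.geometry d) ε p.1.2 i p.2.1 p.2.2))) ∧
          (0 < p.1.1 → ⟪(p.2.1 : EuclideanSpace ℝ d), p.2.2 - (p.1.2 i).2⟫_ℝ < 0 →
            lossConfig (Literature.Analysis.FluidPDE.Torus.geometry d) ε p.1.2 i p.2.1 p.2.2 ∈ hardSphereDomain (Literature.Analysis.FluidPDE.Torus.geometry d) (k + 1) ε →
            (bgsrMarginalFamily hε hε' N β ρ₀) (k + 1) p.1.1 (outRep (Literature.Analysis.FluidPDE.Torus.geometry d) k i (lossConfig (Literature.Analysis.FluidPDE.Torus.geometry d) ε p.1.2 i p.2.1 p.2.2)) =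
              (hsHierarchyModel (d := d) hε hε' (N + 1)).transport (k + 1) p.1.1 ((bgsrMarginalFamily hε hε' N β ρ₀) (k + 1) 0)
                  (outRep (Literature.Analysis.FluidPDE.Torus.geometry d) k i (lossConfig (Literature.Analysis.FluidPDE.Torus.geometry d) ε p.1.2 i p.2.1 p.2.2)) +
                ∫ τ' in (0 : ℝ)..p.1.1, (hsHierarchyModel (d := d) hε hε' (N + 1)).transport (k + 1) (p.1.1 - τ')
                  ((hsHierarchyModel (d := d) hε hε' (N + 1)).op (k + 1) ((bgsrMarginalFamily hε hε' N β ρ₀) (k + 1 + 1) τ'))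
                  (outRep (Literature.Analysis.FluidPDE.Torus.geometry d) k i (lossConfig (Literature.Analysis.FluidPDE.Torus.geometry d) ε p.1.2 i p.2.1 p.2.2)))) :
    bgsr_linearBoltzmannApprox (d := d) :=
  bgsr_linearBoltzmannApprox_of_domainInputs
    (fun hd N ε hε hε' hN β hβ R ρ₀ hc h0 hR h1 s _ _ ht =>
      bgsr_seriesFamily_ae_eq_of_oneStep hε hε' N β ρ₀ hd hβ hc.measurable h0 hR hN
        (hH1 hd N ε hε hε' hN β hβ R ρ₀ hc h0 hR h1) (hH hd N ε hε hε' hN β hβ R ρ₀ hc h0 hR h1) s ht)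
    hsHierarchyModel_respectsAEOn_all
    (fun hd _ hε hε' σ => ae_bgsrRegular_one hε hε' hd σ)

end Kinetic

end

end Literature.MathematicalPhysics.KineticTheory
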